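import Literature.NumberTheory.ModularForms.InterpolationKernelTheorem
import Literature.NumberTheory.ModularForms.InterpolationKernelsClassP
import Mathlib.Analysis.Calculus.InverseFunctionTheorem.FDeriv
import Mathlib.Analysis.Calculus.Deriv.Inverse
import Mathlib.Analysis.Calculus.ContDiff.RCLike
import HarnessLib

/-!
# Local tools for the `τ`-holomorphy of the generating functions (CKMRV §5.1)

Cohn–Kumar–Miller–Radchenko–Viazovska, arXiv:1902.05438, §5.1: near a non-elliptic point `τ₀` the
modular function `j` is locally injective (so `j(z) = j(τ)` with `z, τ` near `τ₀` forces `z = τ`), and for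
fixed `z` the kernels are holomorphic in `τ` wherever `j(τ) ≠ j(z)` (Theorem 4.1 (2),(4)).

PROVED here (using the tree's `differentiableOn_kleinJ`): `kleinJ_injOn_nhds` (local injectivity from
`j′(τ₀) ≠ 0`, inverse function theorem),
`differentiableAt_kernels_left` (holomorphy in `τ` of all kernels off the singular set, in the chart
`ofComplex`).

## References

* H. Cohn, A. Kumar, S. D. Miller, D. Radchenko, M. Viazovska, Ann. of Math. 196 (2022),
  arXiv:1902.05438, Theorem 4.1, §5.1. [CohnEtAl2019]
-/

noncomputable section

open Complex hiding I
open Filter Topology ModularForm EisensteinSeries UpperHalfPlane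
open Complex (I)
open scoped Real MatrixGroups ModularForm Manifold

namespace Literature.NumberTheory.ModularForms

open Literature.NumberTheory.EllipticCurves.ModularForms (kleinJ continuous_kleinJ mdifferentiable_kleinJ
  differentiableOn_kleinJ)

/-! ## Local injectivity of `j` at non-elliptic points -/

/-- `hasStrictDerivAt_kleinJ` (auxiliary). [folklore] -/
theorem hasStrictDerivAt_kleinJ (τ : ℍ) :
    HasStrictDerivAt (kleinJ ∘ ofComplex) (deriv (kleinJ ∘ ofComplex) τ) τ := by
  have han : AnalyticAt ℂ (kleinJ ∘ ofComplex) τ :=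
    differentiableOn_kleinJ.analyticAt (isOpen_upperHalfPlaneSet.mem_nhds τ.im_pos)
  have h := han.contDiffAt.hasStrictDerivAt (n := 1) one_ne_zero
  exact h

/-- **Local injectivity of `j` at a non-elliptic point.** If `j′(τ₀) ≠ 0` there is a neighbourhood of
`τ₀` in `ℂ` on which `j ∘ ofComplex` is injective. [cite: CohnEtAl2019, §5.1] -/
theorem kleinJ_injOn_nhds {τ₀ : ℍ} (hj : deriv (kleinJ ∘ ofComplex) τ₀ ≠ 0) :
    ∃ U ∈ 𝓝 (τ₀ : ℂ), Set.InjOn (kleinJ ∘ ofComplex) U := by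
  have hs := (hasStrictDerivAt_kleinJ τ₀).hasStrictFDerivAt_equiv hj
  have hev := hs.eventually_left_inverse
  refine ⟨{x | hs.localInverse (kleinJ ∘ ofComplex) _ _ ((kleinJ ∘ ofComplex) x) = x}, hev, ?_⟩
  intro x hx y hy hxy
  have hx' : hs.localInverse (kleinJ ∘ ofComplex) _ _ ((kleinJ ∘ ofComplex) x) = x := hx
  have hy' : hs.localInverse (kleinJ ∘ ofComplex) _ _ ((kleinJ ∘ ofComplex) y) = y := hy
  rw [← hx', ← hy', hxy]

/-- A version with a ball. [cite: CohnEtAl2019, §5.1] -/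
theorem kleinJ_injOn_ball {τ₀ : ℍ} (hj : deriv (kleinJ ∘ ofComplex) τ₀ ≠ 0) :
    ∃ ρ : ℝ, 0 < ρ ∧ Metric.ball (τ₀ : ℂ) ρ ⊆ {z : ℂ | 0 < z.im} ∧ Set.InjOn (kleinJ ∘ ofComplex) (Metric.ball (τ₀ : ℂ) ρ) := by
  obtain ⟨U, hU, hinj⟩ := kleinJ_injOn_nhds hj
  have hU' : U ∩ {z : ℂ | 0 < z.im} ∈ 𝓝 (τ₀ : ℂ) := inter_mem hU (isOpen_upperHalfPlaneSet.mem_nhds τ₀.im_pos)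
  obtain ⟨ρ, hρ, hball⟩ := Metric.mem_nhds_iff.1 hU'
  exact ⟨ρ, hρ, fun z hz => (hball hz).2, hinj.mono fun z hz => (hball hz).1⟩

/-! ## Holomorphy in `τ` off the singular set -/

/-- **Holomorphy of the kernels in `τ`** (chart `ofComplex`) at every `τ` with `j(τ) ≠ j(z)`.
[cite: CohnEtAl2019, Theorem 4.1 (2)] -/
theorem differentiableAt_kernels_left {τ z : ℍ} (h : kleinJ τ ≠ kleinJ z) :
    DifferentiableAt ℂ (fun w => kernelPlus8 (ofComplex w) z) τ ∧
    DifferentiableAt ℂ (fun w => kernelMinus8 (ofComplex w) z) τ ∧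
    DifferentiableAt ℂ (fun w => kernelPlus24 (ofComplex w) z) τ ∧
    DifferentiableAt ℂ (fun w => kernelMinus24 (ofComplex w) z) τ ∧
    DifferentiableAt ℂ (fun w => kernel8 (ofComplex w) z) τ ∧
    DifferentiableAt ℂ (fun w => kernel24 (ofComplex w) z) τ := by
  have hΔ : DifferentiableAt ℂ (fun w => ModularForm.discriminant (ofComplex w)) τ :=
    UpperHalfPlane.mdifferentiableAt_iff.mp (isClassP_discriminant.mdifferentiable τ)
  have hj : DifferentiableAt ℂ (fun w => kleinJ (ofComplex w)) τ :=
    UpperHalfPlane.mdifferentiableAt_iff.mp (mdifferentiable_kleinJ τ)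
  have hD1 : DifferentiableAt ℂ (fun w => ModularForm.discriminant (ofComplex w) * ModularForm.discriminant z *
      (kleinJ (ofComplex w) - kleinJ z)) τ := (hΔ.mul_const _).mul (hj.sub_const _)
  have hD2 : DifferentiableAt ℂ (fun w => ModularForm.discriminant (ofComplex w) * ModularForm.discriminant z ^ 2 *
      (kleinJ (ofComplex w) - kleinJ z)) τ := (hΔ.mul_const _).mul (hj.sub_const _)
  have hne1 : ModularForm.discriminant (ofComplex (τ : ℂ)) * ModularForm.discriminant z * (kleinJ (ofComplex (τ : ℂ)) - kleinJ z) ≠ 0 := by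
    rw [ofComplex_apply]
    exact mul_ne_zero (mul_ne_zero (ModularForm.discriminant_ne_zero τ) (ModularForm.discriminant_ne_zero z)) (sub_ne_zero.2 h)
  have hne2 : ModularForm.discriminant (ofComplex (τ : ℂ)) * ModularForm.discriminant z ^ 2 * (kleinJ (ofComplex (τ : ℂ)) - kleinJ z) ≠ 0 := by
    rw [ofComplex_apply]
    exact mul_ne_zero (mul_ne_zero (ModularForm.discriminant_ne_zero τ) (pow_ne_zero _ (ModularForm.discriminant_ne_zero z))) (sub_ne_zero.2 h)
  have n8p : DifferentiableAt ℂ (fun w => numPlus8 (ofComplex w) z) τ :=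
    UpperHalfPlane.mdifferentiableAt_iff.mp ((isClassP_numPlus8_left z).mdifferentiable τ)
  have n8m : DifferentiableAt ℂ (fun w => numMinus8 (ofComplex w) z) τ :=
    UpperHalfPlane.mdifferentiableAt_iff.mp ((isClassP_numMinus8_left z).mdifferentiable τ)
  have n24p : DifferentiableAt ℂ (fun w => numPlus24 (ofComplex w) z) τ :=
    UpperHalfPlane.mdifferentiableAt_iff.mp ((isClassP_numPlus24_left z).mdifferentiable τ)
  have n24m : DifferentiableAt ℂ (fun w => numMinus24 (ofComplex w) z) τ :=
    UpperHalfPlane.mdifferentiableAt_iff.mp ((isClassP_numMinus24_left z).mdifferentiable τ)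
  have c8p : DifferentiableAt ℂ (fun w => kernelPlus8 (ofComplex w) z) τ := by
    have : (fun w => kernelPlus8 (ofComplex w) z) = fun w => numPlus8 (ofComplex w) z /
        (ModularForm.discriminant (ofComplex w) * ModularForm.discriminant z * (kleinJ (ofComplex w) - kleinJ z)) :=
      funext fun w => kernelPlus8_eq_div _ _
    rw [this]; exact n8p.div hD1 hne1
  have c8m : DifferentiableAt ℂ (fun w => kernelMinus8 (ofComplex w) z) τ := by
    have : (fun w => kernelMinus8 (ofComplex w) z) = fun w => numMinus8 (ofComplex w) z /
        (ModularForm.discriminant (ofComplex w) * ModularForm.discriminant z * (kleinJ (ofComplex w) - kleinJ z)) :=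
      funext fun w => kernelMinus8_eq_div _ _
    rw [this]; exact n8m.div hD1 hne1
  have c24p : DifferentiableAt ℂ (fun w => kernelPlus24 (ofComplex w) z) τ := by
    have : (fun w => kernelPlus24 (ofComplex w) z) = fun w => numPlus24 (ofComplex w) z /
        (ModularForm.discriminant (ofComplex w) * ModularForm.discriminant z ^ 2 * (kleinJ (ofComplex w) - kleinJ z)) :=
      funext fun w => kernelPlus24_eq_div _ _
    rw [this]; exact n24p.div hD2 hne2
  have c24m : DifferentiableAt ℂ (fun w => kernelMinus24 (ofComplex w) z) τ := by
    have : (fun w => kernelMinus24 (ofComplex w) z) = fun w => numMinus24 (ofComplex w) z /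
        (ModularForm.discriminant (ofComplex w) * ModularForm.discriminant z ^ 2 * (kleinJ (ofComplex w) - kleinJ z)) :=
      funext fun w => kernelMinus24_eq_div _ _
    rw [this]; exact n24m.div hD2 hne2
  refine ⟨c8p, c8m, c24p, c24m, ?_, ?_⟩
  · show DifferentiableAt ℂ (fun w => (kernelPlus8 (ofComplex w) z + kernelMinus8 (ofComplex w) z) / 2) τ
    exact (c8p.add c8m).div_const 2
  · show DifferentiableAt ℂ (fun w => (kernelPlus24 (ofComplex w) z + kernelMinus24 (ofComplex w) z) / 2) τ
    exact (c24p.add c24m).div_const 2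

end Literature.NumberTheory.ModularForms
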